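import Literature.MathematicalPhysics.PowerSystems.LuriePostnikovSlabCertificate
import Literature.Computation.Certificates.SparseMatrixAlgebra
import Literature.Computation.Certificates.CliqueSumBlockLDL

/-!
# The Lur'e–Postnikov slab certificate matrix in SPARSE FORM — from typed sparse literals to the two
# exact matrix facts of `SlabCertificate` by one clique sweep and in-kernel `LDLᵀ`, for any object

Topic `Literature/MathematicalPhysics/PowerSystems`, namespace
`Literature.MathematicalPhysics.PowerSystems.LyapunovFunctionFamily` (Vu–Turitsyn's bilinear `System =
(A, B, C, δ*)`, `ẋ = Ax − BF(Cx)`; `SlabCertificate` of `LuriePostnikovSlabCertificate.lean`). Compute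
infrastructure of the cell `gridfusion` (custody gridfusion-lit-5): the GENERIC «model-side identity
step» of a clique-decomposed slab row. No named fact, no instance, no `sorry`; two definitions (the
rational twin of the certificate matrix and its sparse-row expression), their laws, and the assembly.

THE PROBLEM IT REMOVES. A slab row needs the two exact facts of `SlabCertificate`:
`P − ε·1 ⪰ 0` and `−𝓛 ⪰ 0`, `𝓛 = [[AᵀP + PA + η·1 − Cᵀ·diag(τab)·C, −PB + (CA)ᵀ·diag(λ) +
Cᵀ·diag(τ(a+b)/2)], [·ᵀ, −diag(λ)·CB − (diag(λ)·CB)ᵀ − diag τ]]`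
[cite: Pai1981, §2.16 eq. (2.64); VuTuritsyn2017, §4.2 Lemma 1]. The certificate producer hands over
`−𝓛` as a SUM OF CLIQUE BLOCKS `Σ_c E_cᵀ S_c E_c` [cite: ZhengFantuzziPapachristodoulou2018, §3.2
Theorem 2]; the kernel side so far re-typed, PER OBJECT, the rational twin of `𝓛` from the model's
`A, B, C`, sparse column lists, product lemmas and `N` row-block decides of the entrywise identity
`−𝓛 = Σ blocks` (≈ 16–32 h of kernel projected at SP-118 scale). Here the identity is GENERIC:

* `slabMatrixQ A B C P η λ τ a b` — the rational twin of `slabMatrix` with the matrices explicit, on the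
  model's own index types `ι ⊕ κ`; `slabMatrix_eq_map_slabMatrixQ` — if `S.A, S.B, S.C` are casts of
  rational matrices then `slabMatrix S (P.map cast) η λ τ a b` IS the cast of the twin (pure algebra);
* `slabMatrixQ_submatrix` — re-indexing the twin along `eι : ι ≃ Fin n`, `eκ : κ ≃ Fin m` (pure algebra);
* `slabSMat n m dn dm sA sB sC sP η λ τ a b : SMat ℚ` — THE SAME MATRIX AS A SPARSE-ROW EXPRESSION in the
  typed sparse literals `sA, sB, sC, sP` (operations of `SparseMatrixAlgebra.lean`), and its law
  `matrixOfSparseRows_slabSMat` (`n ≤ 2^dn`, `m ≤ 2^dm` are the radix widths of the transposes/products);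
* `slabMatrix_eq_sparse` — the three combined: for a `System` whose `A, B, C` are PRESENTED by sparse
  literals (`S.A = ((matrixOfSparseRows n n sA).submatrix eι eι).map cast`, …), `slabMatrix` is the
  re-indexed cast of `matrixOfSparseRows (n+m) (n+m) (slabSMat …)` — so NO literal of `𝓛` is ever written;
* the payoffs `neg_slabMatrix_posSemidef_of_cliqueSweep` (`−𝓛 ⪰ 0` from ONE
  `cliqueSweepS (n+m) 0 (n+m) (SMat.neg (slabSMat …)) blocks = true` decide plus the blocks' PSD facts —
  e.g. `ldlAll blocks = true`, `CliqueSumBlockLDL.lean`), `sub_smul_one_posSemidef_of_cliqueSweep`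
  (`P − ε·1 ⪰ 0` likewise from `cliqueSweepS n 0 n (SMat.sub sP (SMat.scalar n ε)) blocksP`),
  `transpose_eq_of_sub_smul_one_posSemidef` (`Pᵀ = P` is a CONSEQUENCE of `P − ε·1 ⪰ 0`), and the
  one-term constructor `SlabCertificate.ofSparse` (scalar side conditions decided over `ℚ`);
* (§4b) the THIRD matrix fact of a slab row, the rank-one AGGREGATE `s•P − CᵀC ⪰ 0` of the level route
  (`LuriePostnikovSlabInstanceForms.SlabCertificate.rankOne_of_aggregate`), from one more sweep of the
  expression `SMat.sub (SMat.smul s sP) (SMat.mulT dn m sC sC)` against its clique blocks: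
  `smul_sub_transpose_mul_self_posSemidef_of_cliqueSweep(_ldl)`.

* (§4c) the same three payoffs and the constructor `SlabCertificate.ofSparseEq` from ESTABLISHED clique
  identities `matrixOfSparseRows … = blockSum …` — any lane, in particular `k` row-WINDOW decides in `k`
  files assembled by `CliqueSumSparseCheck`'s `matrixOfSparseRows_eq_blockSum_of_sweepWindows` — the
  assembly for `N ≈ 10³` objects (MEASURED on an SP-118-class object, `N = 614`: one `−𝓛` sweep ≈ 91 s of
  kernel, three windows 40 / 43 / 59 s, `P` side 59 s; numbers in §4c).

So the kernel side of a clique-decomposed slab row for ANY object is: sparse literals + two sweep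
decides + the blocks' `LDLᵀ` decides + `SlabCertificate.ofSparse` — the per-object typing is reduced to
presenting `A, B, C` by sparse literals (three `rfl`/`decide` facts). Kernel-checked toy example at the
end (one state, one channel).

MEASURED (farm, `decide +kernel`, 2026-08-27, the cell's ★ #53 object `NE39SP.relLurie (1/10)`: `n = 58`
states, `m = 56` channels, `A`/`B`/`C`/`P` with 20/250/109/204 non-zeros, certificate `j272825`, radix
widths `dn = dm = 6`): `SMat.eqCheck 114 (SMat.neg (slabSMat …)) ⟨the accepted hand-over literal of −𝓛⟩`
21 s (the generic form reproduces the per-object identity exactly); the FUSED sweep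
`cliqueSweepS 114 0 114 (SMat.neg (slabSMat …)) blocksL` (64 clique blocks ≤ 19) 39 s in one decide; the
`P` side `cliqueSweepS 58 0 58 (SMat.sub sP (SMat.scalar 58 ε)) blocksP` + `ldlAll blocksP` (41 blocks)
10 s. Emit every sparse literal as one `def` per row (list-literal elaboration is quadratic per list).
-/

set_option linter.style.longLine false

namespace Literature.MathematicalPhysics.PowerSystems.LyapunovFunctionFamily

open Matrix Literature.Computation.Certificates Literature.Computation.Certificates.PSD

/-! ### §1 The rational twin of the certificate matrix; the cast step -/

section Twin

variable {ι κ : Type*} [Fintype ι] [Fintype κ] [DecidableEq ι] [DecidableEq κ]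

/-- **Rational twin of the slab certificate matrix** `𝓛(A, B, C; P, η, λ, τ, a, b)` with the model
matrices explicit (same block formula as `slabMatrix`).
[cite: Pai1981, §2.16 eq. (2.64); VuTuritsyn2017, §4.2 Lemma 1] -/
def slabMatrixQ (A : Matrix ι ι ℚ) (B : Matrix ι κ ℚ) (C : Matrix κ ι ℚ) (P : Matrix ι ι ℚ) (η : ℚ)
    (lam τ a b : κ → ℚ) : Matrix (ι ⊕ κ) (ι ⊕ κ) ℚ :=
  Matrix.fromBlocks
    (Aᵀ * P + P * A + η • (1 : Matrix ι ι ℚ) - Cᵀ * diagonal (fun k => τ k * (a k * b k)) * C)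
    (-(P * B) + (C * A)ᵀ * diagonal lam + Cᵀ * diagonal (fun k => τ k * (a k + b k) / 2))
    (-(P * B) + (C * A)ᵀ * diagonal lam + Cᵀ * diagonal (fun k => τ k * (a k + b k) / 2))ᵀ
    (-(diagonal lam * (C * B)) - (diagonal lam * (C * B))ᵀ - diagonal τ)

variable {l p q : Type*}

/-- `cast` through a product (plumbing). [folklore] -/
private theorem map_mul_cast [Fintype p] (X : Matrix l p ℚ) (Y : Matrix p q ℚ) :
    (X * Y).map (Rat.cast : ℚ → ℝ) = X.map (Rat.cast : ℚ → ℝ) * Y.map (Rat.cast : ℚ → ℝ) := by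
  ext i j
  simp [Matrix.mul_apply, Rat.cast_sum]

/-- `cast` through a sum (plumbing). [folklore] -/
private theorem map_add_cast (X Y : Matrix l p ℚ) :
    (X + Y).map (Rat.cast : ℚ → ℝ) = X.map (Rat.cast : ℚ → ℝ) + Y.map (Rat.cast : ℚ → ℝ) := by
  ext i j
  simp

/-- `cast` through a difference (plumbing). [folklore] -/
private theorem map_sub_cast (X Y : Matrix l p ℚ) :
    (X - Y).map (Rat.cast : ℚ → ℝ) = X.map (Rat.cast : ℚ → ℝ) - Y.map (Rat.cast : ℚ → ℝ) := by
  ext i j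
  simp

/-- `cast` through a negation (plumbing). [folklore] -/
private theorem map_neg_cast (X : Matrix l p ℚ) :
    (-X).map (Rat.cast : ℚ → ℝ) = -X.map (Rat.cast : ℚ → ℝ) := by
  ext i j
  simp

/-- `cast` through a scalar multiple (plumbing). [folklore] -/
private theorem map_smul_cast (c : ℚ) (X : Matrix l p ℚ) :
    (c • X).map (Rat.cast : ℚ → ℝ) = (c : ℝ) • X.map (Rat.cast : ℚ → ℝ) := by
  ext i j
  simp

/-- `cast` through a transpose (plumbing). [folklore] -/
private theorem map_transpose_cast (X : Matrix l p ℚ) :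
    Xᵀ.map (Rat.cast : ℚ → ℝ) = (X.map (Rat.cast : ℚ → ℝ))ᵀ := rfl

/-- `cast` of a diagonal matrix (plumbing). [folklore] -/
private theorem map_diagonal_cast [DecidableEq l] (d : l → ℚ) :
    (diagonal d).map (Rat.cast : ℚ → ℝ) = diagonal fun i => (d i : ℝ) :=
  Matrix.diagonal_map Rat.cast_zero

/-- `cast` of the identity matrix (plumbing). [folklore] -/
private theorem map_one_cast [DecidableEq l] : (1 : Matrix l l ℚ).map (Rat.cast : ℚ → ℝ) = 1 :=
  Matrix.map_one _ Rat.cast_zero Rat.cast_one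

/-- **Cast step.** If the model matrices are casts of rational matrices then, for rational certificate
data, `slabMatrix` is the cast of the rational twin (pure algebra, any index types).
[cite: Pai1981, §2.16 eq. (2.64); VuTuritsyn2017, §4.2 Lemma 1] -/
theorem slabMatrix_eq_map_slabMatrixQ (S : System ι κ) {A : Matrix ι ι ℚ} {B : Matrix ι κ ℚ}
    {C : Matrix κ ι ℚ} (hA : S.A = A.map (Rat.cast : ℚ → ℝ)) (hB : S.B = B.map (Rat.cast : ℚ → ℝ))
    (hC : S.C = C.map (Rat.cast : ℚ → ℝ)) (P : Matrix ι ι ℚ) (η : ℚ) (lam τ a b : κ → ℚ) :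
    slabMatrix S (P.map (Rat.cast : ℚ → ℝ)) (η : ℝ) (fun k => (lam k : ℝ)) (fun k => (τ k : ℝ))
        (fun k => (a k : ℝ)) (fun k => (b k : ℝ))
      = (slabMatrixQ A B C P η lam τ a b).map (Rat.cast : ℚ → ℝ) := by
  rw [slabMatrix, slabL11, slabL12, slabL22, hA, hB, hC, slabMatrixQ, Matrix.fromBlocks_map]
  simp only [map_sub_cast, map_add_cast, map_neg_cast, map_mul_cast, map_smul_cast, map_transpose_cast,
    map_diagonal_cast, map_one_cast, Rat.cast_mul, Rat.cast_add, Rat.cast_div, Rat.cast_ofNat]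

/-! ### §2 Re-indexing the twin to `Fin n ⊕ Fin m` -/

variable {α : Type*}

/-- Collecting a sum of re-indexed matrices (plumbing). [folklore] -/
private theorem subm_add [Add α] {m₀ n₀ l₀ o₀ : Type*} (X Y : Matrix m₀ n₀ α) (r : l₀ → m₀)
    (c : o₀ → n₀) : X.submatrix r c + Y.submatrix r c = (X + Y).submatrix r c := rfl

/-- Collecting a difference of re-indexed matrices (plumbing). [folklore] -/
private theorem subm_sub [Sub α] {m₀ n₀ l₀ o₀ : Type*} (X Y : Matrix m₀ n₀ α) (r : l₀ → m₀)
    (c : o₀ → n₀) : X.submatrix r c - Y.submatrix r c = (X - Y).submatrix r c := rfl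

/-- Collecting a negated re-indexed matrix (plumbing). [folklore] -/
private theorem subm_neg [Neg α] {m₀ n₀ l₀ o₀ : Type*} (X : Matrix m₀ n₀ α) (r : l₀ → m₀)
    (c : o₀ → n₀) : -X.submatrix r c = (-X).submatrix r c := rfl

/-- Collecting a scaled re-indexed matrix (plumbing). [folklore] -/
private theorem subm_smul [SMul ℚ α] {m₀ n₀ l₀ o₀ : Type*} (s : ℚ) (X : Matrix m₀ n₀ α) (r : l₀ → m₀)
    (c : o₀ → n₀) : s • X.submatrix r c = (s • X).submatrix r c := rfl

omit [Fintype ι] [Fintype κ] [DecidableEq ι] [DecidableEq κ] in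
/-- Re-indexing a block matrix along `Sum.map` (plumbing). [folklore] -/
private theorem fromBlocks_submatrix_sumMap {n m : ℕ} (X : Matrix (Fin n) (Fin n) α)
    (Y : Matrix (Fin n) (Fin m) α) (Z : Matrix (Fin m) (Fin n) α) (W : Matrix (Fin m) (Fin m) α)
    (f : ι → Fin n) (g : κ → Fin m) :
    (Matrix.fromBlocks X Y Z W).submatrix (Sum.map f g) (Sum.map f g)
      = Matrix.fromBlocks (X.submatrix f f) (Y.submatrix f g) (Z.submatrix g f) (W.submatrix g g) := by
  ext (i | i) (j | j) <;> rfl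

/-- **Re-indexing step.** The twin of re-indexed matrices is the re-indexed twin (pure algebra).
[cite: Pai1981, §2.16 eq. (2.64); VuTuritsyn2017, §4.2 Lemma 1] -/
theorem slabMatrixQ_submatrix {n m : ℕ} (eι : ι ≃ Fin n) (eκ : κ ≃ Fin m)
    (Af : Matrix (Fin n) (Fin n) ℚ) (Bf : Matrix (Fin n) (Fin m) ℚ) (Cf : Matrix (Fin m) (Fin n) ℚ)
    (Pf : Matrix (Fin n) (Fin n) ℚ) (η : ℚ) (lamf τf af bf : Fin m → ℚ) :
    slabMatrixQ (Af.submatrix eι eι) (Bf.submatrix eι eκ) (Cf.submatrix eκ eι) (Pf.submatrix eι eι) η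
        (lamf ∘ eκ) (τf ∘ eκ) (af ∘ eκ) (bf ∘ eκ)
      = (slabMatrixQ Af Bf Cf Pf η lamf τf af bf).submatrix (Sum.map eι eκ) (Sum.map eι eκ) := by
  have hd1 : (diagonal fun k => (τf ∘ eκ) k * ((af ∘ eκ) k * (bf ∘ eκ) k))
      = (diagonal fun k => τf k * (af k * bf k)).submatrix eκ eκ := by
    rw [Matrix.submatrix_diagonal_equiv]; rfl
  have hd2 : (diagonal fun k => (τf ∘ eκ) k * ((af ∘ eκ) k + (bf ∘ eκ) k) / 2)
      = (diagonal fun k => τf k * (af k + bf k) / 2).submatrix eκ eκ := by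
    rw [Matrix.submatrix_diagonal_equiv]; rfl
  have hdl : diagonal (lamf ∘ eκ) = (diagonal lamf).submatrix eκ eκ :=
    (Matrix.submatrix_diagonal_equiv _ _).symm
  have hdt : diagonal (τf ∘ eκ) = (diagonal τf).submatrix eκ eκ :=
    (Matrix.submatrix_diagonal_equiv _ _).symm
  have h1 : (1 : Matrix ι ι ℚ) = (1 : Matrix (Fin n) (Fin n) ℚ).submatrix eι eι :=
    (Matrix.submatrix_one_equiv _).symm
  rw [slabMatrixQ, hd1, hd2, hdl, hdt, h1, slabMatrixQ, fromBlocks_submatrix_sumMap]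
  simp only [Matrix.transpose_submatrix, Matrix.submatrix_mul_equiv, subm_add, subm_sub, subm_neg,
    subm_smul]

end Twin

/-! ### §3 The certificate matrix as a sparse-row expression in the typed sparse literals -/

section Sparse

/-- List read-back of `List.ofFn` (plumbing). [folklore] -/
private theorem getD_ofFn {m : ℕ} (g : Fin m → ℚ) (i : Fin m) : (List.ofFn g).getD i.val 0 = g i := by
  rw [List.getD_eq_getElem?_getD, List.getElem?_ofFn]
  simp [i.isLt]

/-- The same as a function identity (plumbing). [folklore] -/
private theorem getD_ofFn_fun {m : ℕ} (g : Fin m → ℚ) :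
    (fun i : Fin m => (List.ofFn g).getD i.val 0) = g :=
  funext (getD_ofFn g)

/-- **Sparse-row expression of the state block** `AᵀP + PA + η·1 − Cᵀ·diag(τab)·C` (`n` states,
`m` channels; `dn`, `dm` radix widths with `n ≤ 2^dn`, `m ≤ 2^dm`).
[cite: Pai1981, §2.16 eq. (2.64) (first equation); VuTuritsyn2017, §4.2 Lemma 1] -/
def slabSMat11 (n m dn : ℕ) (sA sC sP : SMat ℚ) (η : ℚ) (τ a b : Fin m → ℚ) : SMat ℚ :=
  SMat.sub (SMat.add (SMat.add (SMat.mulT dn n sA sP) (SMat.mul dn dn n n sP sA)) (SMat.scalar n η))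
    (SMat.mulT dn m sC (SMat.scaleRows (List.ofFn fun k => τ k * (a k * b k)) sC))

/-- **Sparse-row expression of the cross block** `−PB + (CA)ᵀ·diag(λ) + Cᵀ·diag(τ(a+b)/2)`.
[cite: Pai1981, §2.16 eq. (2.64) (second equation); VuTuritsyn2017, §4.2 Lemma 1] -/
def slabSMat12 (n m dn dm : ℕ) (sA sB sC sP : SMat ℚ) (lam τ a b : Fin m → ℚ) : SMat ℚ :=
  SMat.add (SMat.add (SMat.neg (SMat.mul dn dn n n sP sB))
      (SMat.transpose dn m (SMat.scaleRows (List.ofFn lam) (SMat.mul dm dn m n sC sA))))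
    (SMat.transpose dn m (SMat.scaleRows (List.ofFn fun k => τ k * (a k + b k) / 2) sC))

/-- **Sparse-row expression of the channel block** `−diag(λ)·CB − (diag(λ)·CB)ᵀ − diag τ`.
[cite: Pai1981, §2.16 eq. (2.64) (third equation); VuTuritsyn2017, §4.2 Lemma 1] -/
def slabSMat22 (n m dn dm : ℕ) (sB sC : SMat ℚ) (lam τ : Fin m → ℚ) : SMat ℚ :=
  SMat.sub (SMat.neg (SMat.add (SMat.scaleRows (List.ofFn lam) (SMat.mul dm dn m n sC sB))
      (SMat.transpose dm m (SMat.scaleRows (List.ofFn lam) (SMat.mul dm dn m n sC sB)))))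
    (SMat.diagonal (List.ofFn τ))

/-- **The certificate matrix `𝓛` as ONE sparse-row expression** in the typed sparse literals
`sA` (`n × n`), `sB` (`n × m`), `sC` (`m × n`), `sP` (`n × n`) and the rational certificate scalars —
the matrix the clique sweep is run against (`SMat.neg` of it), never written out.
[cite: Pai1981, §2.16 eq. (2.64); VuTuritsyn2017, §4.2 Lemma 1] -/
def slabSMat (n m dn dm : ℕ) (sA sB sC sP : SMat ℚ) (η : ℚ) (lam τ a b : Fin m → ℚ) : SMat ℚ :=
  SMat.fromBlocks n n (slabSMat11 n m dn sA sC sP η τ a b) (slabSMat12 n m dn dm sA sB sC sP lam τ a b)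
    (SMat.transpose dm n (slabSMat12 n m dn dm sA sB sC sP lam τ a b))
    (slabSMat22 n m dn dm sB sC lam τ)

variable {n m dn dm : ℕ}

/-- Law of the state block. [cite: Pai1981, §2.16 eq. (2.64); BarrettEtAl1994, §4.3.1, p. 57] -/
theorem matrixOfSparseRows_slabSMat11 (hn : n ≤ 2 ^ dn) (sA sC sP : SMat ℚ) (η : ℚ)
    (τ a b : Fin m → ℚ) :
    matrixOfSparseRows n n (slabSMat11 n m dn sA sC sP η τ a b)
      = (matrixOfSparseRows n n sA)ᵀ * matrixOfSparseRows n n sP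
          + matrixOfSparseRows n n sP * matrixOfSparseRows n n sA + η • (1 : Matrix (Fin n) (Fin n) ℚ)
          - (matrixOfSparseRows m n sC)ᵀ * diagonal (fun k => τ k * (a k * b k))
              * matrixOfSparseRows m n sC := by
  rw [slabSMat11, SMat.matrixOfSparseRows_sub, SMat.matrixOfSparseRows_add, SMat.matrixOfSparseRows_add,
    SMat.matrixOfSparseRows_mulT n n hn, SMat.matrixOfSparseRows_mul n hn hn,
    SMat.matrixOfSparseRows_scalar, SMat.matrixOfSparseRows_mulT m n hn,
    SMat.matrixOfSparseRows_scaleRows, getD_ofFn_fun, Matrix.mul_assoc]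

/-- `(diag d · M)ᵀ = Mᵀ · diag d` (plumbing). [folklore] -/
private theorem transpose_diagonal_mul {m' n' : ℕ} (d : Fin m' → ℚ) (M : Matrix (Fin m') (Fin n') ℚ) :
    (diagonal d * M)ᵀ = Mᵀ * diagonal d := by
  rw [Matrix.transpose_mul, Matrix.diagonal_transpose]

/-- Law of the cross block. [cite: Pai1981, §2.16 eq. (2.64); BarrettEtAl1994, §4.3.1, p. 57] -/
theorem matrixOfSparseRows_slabSMat12 (hn : n ≤ 2 ^ dn) (hm : m ≤ 2 ^ dm) (sA sB sC sP : SMat ℚ)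
    (lam τ a b : Fin m → ℚ) :
    matrixOfSparseRows n m (slabSMat12 n m dn dm sA sB sC sP lam τ a b)
      = -(matrixOfSparseRows n n sP * matrixOfSparseRows n m sB)
          + (matrixOfSparseRows m n sC * matrixOfSparseRows n n sA)ᵀ * diagonal lam
          + (matrixOfSparseRows m n sC)ᵀ * diagonal (fun k => τ k * (a k + b k) / 2) := by
  rw [slabSMat12, SMat.matrixOfSparseRows_add, SMat.matrixOfSparseRows_add, SMat.matrixOfSparseRows_neg,
    SMat.matrixOfSparseRows_mul m hn hn, SMat.matrixOfSparseRows_transpose m hn,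
    SMat.matrixOfSparseRows_transpose m hn, SMat.matrixOfSparseRows_scaleRows,
    SMat.matrixOfSparseRows_scaleRows, SMat.matrixOfSparseRows_mul n hm hn, getD_ofFn_fun,
    getD_ofFn_fun, transpose_diagonal_mul, transpose_diagonal_mul]

/-- Law of the channel block. [cite: Pai1981, §2.16 eq. (2.64); BarrettEtAl1994, §4.3.1, p. 57] -/
theorem matrixOfSparseRows_slabSMat22 (hn : n ≤ 2 ^ dn) (hm : m ≤ 2 ^ dm) (sB sC : SMat ℚ)
    (lam τ : Fin m → ℚ) :
    matrixOfSparseRows m m (slabSMat22 n m dn dm sB sC lam τ)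
      = -(diagonal lam * (matrixOfSparseRows m n sC * matrixOfSparseRows n m sB))
          - (diagonal lam * (matrixOfSparseRows m n sC * matrixOfSparseRows n m sB))ᵀ - diagonal τ := by
  rw [slabSMat22, SMat.matrixOfSparseRows_sub, SMat.matrixOfSparseRows_neg, SMat.matrixOfSparseRows_add,
    SMat.matrixOfSparseRows_transpose m hm, SMat.matrixOfSparseRows_scaleRows,
    SMat.matrixOfSparseRows_mul m hm hn, SMat.matrixOfSparseRows_diagonal, getD_ofFn_fun, getD_ofFn_fun]
  abel

/-- **Law of the sparse form**: read as a matrix, `slabSMat` is the rational twin on `Fin n ⊕ Fin m`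
(re-indexed to `Fin (n + m)`). [cite: Pai1981, §2.16 eq. (2.64); VuTuritsyn2017, §4.2 Lemma 1] -/
theorem matrixOfSparseRows_slabSMat (hn : n ≤ 2 ^ dn) (hm : m ≤ 2 ^ dm) (sA sB sC sP : SMat ℚ) (η : ℚ)
    (lam τ a b : Fin m → ℚ) :
    matrixOfSparseRows (n + m) (n + m) (slabSMat n m dn dm sA sB sC sP η lam τ a b)
      = (slabMatrixQ (matrixOfSparseRows n n sA) (matrixOfSparseRows n m sB) (matrixOfSparseRows m n sC)
          (matrixOfSparseRows n n sP) η lam τ a b).submatrix finSumFinEquiv.symm finSumFinEquiv.symm := by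
  rw [slabSMat, SMat.matrixOfSparseRows_fromBlocks, SMat.matrixOfSparseRows_transpose n hm,
    matrixOfSparseRows_slabSMat11 hn, matrixOfSparseRows_slabSMat12 hn hm,
    matrixOfSparseRows_slabSMat22 hn hm, slabMatrixQ]

end Sparse

/-! ### §4 Assembly: the certificate's two exact facts from sweeps and block certificates -/

section Assembly

variable {ι κ : Type*} [Fintype ι] [Fintype κ] [DecidableEq ι] [DecidableEq κ]
variable {n m dn dm : ℕ}

/-- **The certificate matrix of a sparsely presented object is the re-indexed cast of the sparse form**
(no literal of `𝓛` anywhere). [cite: Pai1981, §2.16 eq. (2.64); VuTuritsyn2017, §4.2 Lemma 1] -/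
theorem slabMatrix_eq_sparse (S : System ι κ) (eι : ι ≃ Fin n) (eκ : κ ≃ Fin m) (hn : n ≤ 2 ^ dn)
    (hm : m ≤ 2 ^ dm) (sA sB sC sP : SMat ℚ) (η : ℚ) (lamf τf af bf : Fin m → ℚ)
    (hA : S.A = ((matrixOfSparseRows n n sA).submatrix eι eι).map (Rat.cast : ℚ → ℝ))
    (hB : S.B = ((matrixOfSparseRows n m sB).submatrix eι eκ).map (Rat.cast : ℚ → ℝ))
    (hC : S.C = ((matrixOfSparseRows m n sC).submatrix eκ eι).map (Rat.cast : ℚ → ℝ)) :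
    slabMatrix S (((matrixOfSparseRows n n sP).submatrix eι eι).map (Rat.cast : ℚ → ℝ)) (η : ℝ)
        (fun k => (lamf (eκ k) : ℝ)) (fun k => (τf (eκ k) : ℝ)) (fun k => (af (eκ k) : ℝ))
        (fun k => (bf (eκ k) : ℝ))
      = ((matrixOfSparseRows (n + m) (n + m) (slabSMat n m dn dm sA sB sC sP η lamf τf af bf)).submatrix
          ((eι.sumCongr eκ).trans finSumFinEquiv) ((eι.sumCongr eκ).trans finSumFinEquiv)).map
          (Rat.cast : ℚ → ℝ) := by
  rw [slabMatrix_eq_map_slabMatrixQ S hA hB hC, matrixOfSparseRows_slabSMat hn hm,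
    Matrix.submatrix_submatrix]
  have he : (finSumFinEquiv.symm ∘ ((eι.sumCongr eκ).trans finSumFinEquiv) : ι ⊕ κ → Fin n ⊕ Fin m)
      = Sum.map eι eκ := by
    funext x
    simp
  rw [he, ← slabMatrixQ_submatrix]
  rfl

variable {K : Type*}

omit [Fintype ι] [Fintype κ] [DecidableEq ι] [DecidableEq κ] in
/-- Re-indexing a cast negation (plumbing). [folklore] -/
private theorem neg_submatrix_map {N : ℕ} (M : Matrix (Fin N) (Fin N) ℚ) (e : ι ⊕ κ → Fin N) :
    -((M.submatrix e e).map (Rat.cast : ℚ → ℝ)) = ((-M).map (Rat.cast : ℚ → ℝ)).submatrix e e := by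
  ext i j
  simp

/-- **`−𝓛 ⪰ 0` for a sparsely presented object from ONE clique sweep and the blocks' PSD facts.**
The sweep is run against the expression `SMat.neg (slabSMat …)`; the blocks' facts come from
`ldlAll` / `ldlWindow` (`CliqueSumBlockLDL.lean`) or any other PSD lane.
[cite: ZhengFantuzziPapachristodoulou2018, §3.2 Theorem 2 («if» direction); Pai1981, §2.16 eq. (2.64)] -/
theorem neg_slabMatrix_posSemidef_of_cliqueSweep (S : System ι κ) (eι : ι ≃ Fin n) (eκ : κ ≃ Fin m)
    (hn : n ≤ 2 ^ dn) (hm : m ≤ 2 ^ dm) (sA sB sC sP : SMat ℚ) (η : ℚ) (lamf τf af bf : Fin m → ℚ)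
    (hA : S.A = ((matrixOfSparseRows n n sA).submatrix eι eι).map (Rat.cast : ℚ → ℝ))
    (hB : S.B = ((matrixOfSparseRows n m sB).submatrix eι eκ).map (Rat.cast : ℚ → ℝ))
    (hC : S.C = ((matrixOfSparseRows m n sC).submatrix eκ eι).map (Rat.cast : ℚ → ℝ))
    {blocks : List (Block (n + m) ℚ)}
    (hchk : cliqueSweepS (n + m) 0 (n + m)
      (SMat.neg (slabSMat n m dn dm sA sB sC sP η lamf τf af bf)) blocks = true)
    (hS : ∀ bk ∈ blocks, (bk.2.map (Rat.cast : ℚ → ℝ)).PosSemidef) :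
    (-(slabMatrix S (((matrixOfSparseRows n n sP).submatrix eι eι).map (Rat.cast : ℚ → ℝ)) (η : ℝ)
        (fun k => (lamf (eκ k) : ℝ)) (fun k => (τf (eκ k) : ℝ)) (fun k => (af (eκ k) : ℝ))
        (fun k => (bf (eκ k) : ℝ)))).PosSemidef := by
  have hpsd := posSemidef_map_of_cliqueSweepS (K := ℝ) hchk hS
  rw [SMat.matrixOfSparseRows_neg] at hpsd
  rw [slabMatrix_eq_sparse S eι eκ hn hm sA sB sC sP η lamf τf af bf hA hB hC, neg_submatrix_map]
  exact hpsd.submatrix _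

/-- The same with the blocks certified by the batched in-kernel `LDLᵀ` (`ldlAll blocks = true`).
[cite: ZhengFantuzziPapachristodoulou2018, §3.2 Theorem 2 («if» direction); BlekhermanParriloThomas2012, App. A.1.2] -/
theorem neg_slabMatrix_posSemidef_of_cliqueSweep_ldl (S : System ι κ) (eι : ι ≃ Fin n)
    (eκ : κ ≃ Fin m) (hn : n ≤ 2 ^ dn) (hm : m ≤ 2 ^ dm) (sA sB sC sP : SMat ℚ) (η : ℚ)
    (lamf τf af bf : Fin m → ℚ)
    (hA : S.A = ((matrixOfSparseRows n n sA).submatrix eι eι).map (Rat.cast : ℚ → ℝ))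
    (hB : S.B = ((matrixOfSparseRows n m sB).submatrix eι eκ).map (Rat.cast : ℚ → ℝ))
    (hC : S.C = ((matrixOfSparseRows m n sC).submatrix eκ eι).map (Rat.cast : ℚ → ℝ))
    {blocks : List (Block (n + m) ℚ)}
    (hchk : cliqueSweepS (n + m) 0 (n + m)
      (SMat.neg (slabSMat n m dn dm sA sB sC sP η lamf τf af bf)) blocks = true)
    (hl : ldlAll blocks = true) :
    (-(slabMatrix S (((matrixOfSparseRows n n sP).submatrix eι eι).map (Rat.cast : ℚ → ℝ)) (η : ℝ)
        (fun k => (lamf (eκ k) : ℝ)) (fun k => (τf (eκ k) : ℝ)) (fun k => (af (eκ k) : ℝ))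
        (fun k => (bf (eκ k) : ℝ)))).PosSemidef :=
  neg_slabMatrix_posSemidef_of_cliqueSweep S eι eκ hn hm sA sB sC sP η lamf τf af bf hA hB hC hchk
    (forall_posSemidef_of_ldlAll hl)

omit [Fintype ι] [Fintype κ] [DecidableEq κ] in
/-- Re-indexing a cast shift (plumbing). [folklore] -/
private theorem submatrix_map_sub_smul_one (Pf : Matrix (Fin n) (Fin n) ℚ) (ε : ℚ) (eι : ι ≃ Fin n) :
    (Pf.submatrix eι eι).map (Rat.cast : ℚ → ℝ) - (ε : ℝ) • (1 : Matrix ι ι ℝ)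
      = ((Pf - ε • (1 : Matrix (Fin n) (Fin n) ℚ)).map (Rat.cast : ℚ → ℝ)).submatrix eι eι := by
  ext i j
  by_cases h : i = j
  · subst h; simp
  · simp [h]

omit [Fintype ι] in
/-- **`P − ε·1 ⪰ 0` for the sparsely presented `P`** from ONE sweep of `SMat.sub sP (SMat.scalar n ε)`
against the `P`-side clique blocks and their PSD facts.
[cite: ZhengFantuzziPapachristodoulou2018, §3.2 Theorem 2 («if» direction)] -/
theorem sub_smul_one_posSemidef_of_cliqueSweep (eι : ι ≃ Fin n) (sP : SMat ℚ) (ε : ℚ)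
    {blocksP : List (Block n ℚ)} (hchk : cliqueSweepS n 0 n (SMat.sub sP (SMat.scalar n ε)) blocksP = true)
    (hS : ∀ bk ∈ blocksP, (bk.2.map (Rat.cast : ℚ → ℝ)).PosSemidef) :
    (((matrixOfSparseRows n n sP).submatrix eι eι).map (Rat.cast : ℚ → ℝ)
        - (ε : ℝ) • (1 : Matrix ι ι ℝ)).PosSemidef := by
  have hpsd := posSemidef_map_of_cliqueSweepS (K := ℝ) hchk hS
  rw [SMat.matrixOfSparseRows_sub, SMat.matrixOfSparseRows_scalar] at hpsd
  rw [submatrix_map_sub_smul_one]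
  exact hpsd.submatrix _

omit [Fintype ι] in
/-- The same with the `P`-blocks certified by `ldlAll`.
[cite: ZhengFantuzziPapachristodoulou2018, §3.2 Theorem 2 («if» direction); BlekhermanParriloThomas2012, App. A.1.2] -/
theorem sub_smul_one_posSemidef_of_cliqueSweep_ldl (eι : ι ≃ Fin n) (sP : SMat ℚ) (ε : ℚ)
    {blocksP : List (Block n ℚ)} (hchk : cliqueSweepS n 0 n (SMat.sub sP (SMat.scalar n ε)) blocksP = true)
    (hl : ldlAll blocksP = true) :
    (((matrixOfSparseRows n n sP).submatrix eι eι).map (Rat.cast : ℚ → ℝ)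
        - (ε : ℝ) • (1 : Matrix ι ι ℝ)).PosSemidef :=
  sub_smul_one_posSemidef_of_cliqueSweep eι sP ε hchk (forall_posSemidef_of_ldlAll hl)

omit [Fintype ι] [DecidableEq κ] [Fintype κ] in
/-- **`Pᵀ = P` is a consequence of `P − ε·1 ⪰ 0`** (a positive semidefinite real matrix is symmetric),
so the certificate's symmetry field needs no separate check — positive semidefinite matrices are taken in `𝒮ⁿ`, and
Mathlib's `Matrix.PosSemidef` carries the Hermitian part. [cite: BlekhermanParriloThomas2012, App. A.1.1 Proposition A.1 («Let A ∈ 𝒮ⁿ be a symmetric matrix»), p. 429] -/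
theorem transpose_eq_of_sub_smul_one_posSemidef {P : Matrix ι ι ℝ} {ε : ℝ}
    (h : (P - ε • (1 : Matrix ι ι ℝ)).PosSemidef) : Pᵀ = P := by
  have h2 : (P - ε • (1 : Matrix ι ι ℝ))ᴴ = P - ε • 1 := h.1
  rw [Matrix.conjTranspose_eq_transpose_of_trivial, Matrix.transpose_sub, Matrix.transpose_smul,
    Matrix.transpose_one] at h2
  exact sub_left_injective h2

/-- **One-term constructor of a slab certificate for a sparsely presented object**: sparse literals,
the two sweep decides, the blocks' PSD facts (any lane) and the scalar side conditions over `ℚ`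
(decidable) — nothing typed per object beyond the presentation of `A, B, C`.
[cite: Pai1981, §2.16 Theorem [18] eqs. (2.63)–(2.64); VuTuritsyn2017, §4.2 Lemma 1; ZhengFantuzziPapachristodoulou2018, §3.2 Theorem 2] -/
noncomputable def SlabCertificate.ofSparse (S : System ι κ) (eι : ι ≃ Fin n) (eκ : κ ≃ Fin m)
    (hn : n ≤ 2 ^ dn) (hm : m ≤ 2 ^ dm) (sA sB sC sP : SMat ℚ) (ε η : ℚ) (lamf τf af bf : Fin m → ℚ)
    (hA : S.A = ((matrixOfSparseRows n n sA).submatrix eι eι).map (Rat.cast : ℚ → ℝ))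
    (hB : S.B = ((matrixOfSparseRows n m sB).submatrix eι eκ).map (Rat.cast : ℚ → ℝ))
    (hC : S.C = ((matrixOfSparseRows m n sC).submatrix eκ eι).map (Rat.cast : ℚ → ℝ))
    (hε : 0 < ε) (hη : 0 < η) (hτ : ∀ k, 0 ≤ τf k) (hlam : ∀ k, 0 ≤ lamf k)
    (ha : ∀ k, 0 < lamf k → 0 ≤ af k)
    {blocksP : List (Block n ℚ)} (hchkP : cliqueSweepS n 0 n (SMat.sub sP (SMat.scalar n ε)) blocksP = true)
    (hSP : ∀ bk ∈ blocksP, (bk.2.map (Rat.cast : ℚ → ℝ)).PosSemidef)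
    {blocks : List (Block (n + m) ℚ)}
    (hchk : cliqueSweepS (n + m) 0 (n + m)
      (SMat.neg (slabSMat n m dn dm sA sB sC sP η lamf τf af bf)) blocks = true)
    (hS : ∀ bk ∈ blocks, (bk.2.map (Rat.cast : ℚ → ℝ)).PosSemidef) : SlabCertificate S where
  P := ((matrixOfSparseRows n n sP).submatrix eι eι).map (Rat.cast : ℚ → ℝ)
  ε := ε
  η := η
  τ := fun k => (τf (eκ k) : ℝ)
  lam := fun k => (lamf (eκ k) : ℝ)
  a := fun k => (af (eκ k) : ℝ)
  b := fun k => (bf (eκ k) : ℝ)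
  P_symm := transpose_eq_of_sub_smul_one_posSemidef
    (sub_smul_one_posSemidef_of_cliqueSweep eι sP ε hchkP hSP)
  ε_pos := by exact_mod_cast hε
  η_pos := by exact_mod_cast hη
  P_ge := sub_smul_one_posSemidef_of_cliqueSweep eι sP ε hchkP hSP
  τ_nonneg := fun k => by exact_mod_cast hτ (eκ k)
  lam_nonneg := fun k => by exact_mod_cast hlam (eκ k)
  a_nonneg_of_lam_pos := fun k hk => by
    have hk' : 0 < lamf (eκ k) := by exact_mod_cast hk
    exact_mod_cast ha (eκ k) hk'
  lmi := neg_slabMatrix_posSemidef_of_cliqueSweep S eι eκ hn hm sA sB sC sP η lamf τf af bf hA hB hC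
    hchk hS

/-- The certificate's `P` is the presented one (API: the quadratic part of `V = xᵀPx + 2Σ λ∫F`).
[cite: Pai1981, §2.16 eq. (2.63)] -/
theorem SlabCertificate.ofSparse_P (S : System ι κ) (eι : ι ≃ Fin n) (eκ : κ ≃ Fin m)
    (hn : n ≤ 2 ^ dn) (hm : m ≤ 2 ^ dm) (sA sB sC sP : SMat ℚ) (ε η : ℚ) (lamf τf af bf : Fin m → ℚ)
    (hA : S.A = ((matrixOfSparseRows n n sA).submatrix eι eι).map (Rat.cast : ℚ → ℝ))
    (hB : S.B = ((matrixOfSparseRows n m sB).submatrix eι eκ).map (Rat.cast : ℚ → ℝ))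
    (hC : S.C = ((matrixOfSparseRows m n sC).submatrix eκ eι).map (Rat.cast : ℚ → ℝ))
    (hε : 0 < ε) (hη : 0 < η) (hτ : ∀ k, 0 ≤ τf k) (hlam : ∀ k, 0 ≤ lamf k)
    (ha : ∀ k, 0 < lamf k → 0 ≤ af k)
    {blocksP : List (Block n ℚ)} (hchkP : cliqueSweepS n 0 n (SMat.sub sP (SMat.scalar n ε)) blocksP = true)
    (hSP : ∀ bk ∈ blocksP, (bk.2.map (Rat.cast : ℚ → ℝ)).PosSemidef)
    {blocks : List (Block (n + m) ℚ)}
    (hchk : cliqueSweepS (n + m) 0 (n + m)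
      (SMat.neg (slabSMat n m dn dm sA sB sC sP η lamf τf af bf)) blocks = true)
    (hS : ∀ bk ∈ blocks, (bk.2.map (Rat.cast : ℚ → ℝ)).PosSemidef) :
    (SlabCertificate.ofSparse S eι eκ hn hm sA sB sC sP ε η lamf τf af bf hA hB hC hε hη hτ hlam ha hchkP
        hSP hchk hS).P = ((matrixOfSparseRows n n sP).submatrix eι eι).map (Rat.cast : ℚ → ℝ) := rfl

end Assembly

/-! ### §4b The rank-one aggregate `s•P − CᵀC ⪰ 0` of the level route, from one sweep -/

section RankOne

variable {ι κ : Type*} [Fintype ι] [Fintype κ]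
variable {n m dn : ℕ}

omit [Fintype ι] in
/-- Re-indexing the cast aggregate (plumbing). [folklore] -/
private theorem submatrix_map_smul_sub_transpose_mul (Pf : Matrix (Fin n) (Fin n) ℚ)
    (Cf : Matrix (Fin m) (Fin n) ℚ) (s : ℚ) (eι : ι ≃ Fin n) (eκ : κ ≃ Fin m) :
    (s : ℝ) • (Pf.submatrix eι eι).map (Rat.cast : ℚ → ℝ)
        - ((Cf.submatrix eκ eι).map (Rat.cast : ℚ → ℝ))ᵀ * (Cf.submatrix eκ eι).map (Rat.cast : ℚ → ℝ)
      = ((s • Pf - Cfᵀ * Cf).map (Rat.cast : ℚ → ℝ)).submatrix eι eι := by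
  rw [← Matrix.submatrix_map, ← Matrix.submatrix_map, Matrix.transpose_submatrix, Matrix.submatrix_mul_equiv,
    map_sub_cast, map_smul_cast, map_mul_cast, map_transpose_cast]
  rfl

/-- **`s•P − CᵀC ⪰ 0` for a sparsely presented object from ONE clique sweep** of the expression
`SMat.sub (SMat.smul s sP) (SMat.mulT dn m sC sC)` (same sparsity as `P`) and the blocks' PSD facts — the
single aggregate fact that feeds `SlabCertificate.rankOne_of_aggregate` (all `|κ|` rank-one level facts at
once). [cite: ZhengFantuzziPapachristodoulou2018, §3.2 Theorem 2 («if» direction); VuTuritsyn2017, §4.3 Theorem 1 (the level as a minimum over lines)] -/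
theorem smul_sub_transpose_mul_self_posSemidef_of_cliqueSweep (S : System ι κ) (eι : ι ≃ Fin n)
    (eκ : κ ≃ Fin m) (hn : n ≤ 2 ^ dn) (sC sP : SMat ℚ) (s : ℚ)
    (hC : S.C = ((matrixOfSparseRows m n sC).submatrix eκ eι).map (Rat.cast : ℚ → ℝ))
    {blocksR : List (Block n ℚ)}
    (hchk : cliqueSweepS n 0 n (SMat.sub (SMat.smul s sP) (SMat.mulT dn m sC sC)) blocksR = true)
    (hS : ∀ bk ∈ blocksR, (bk.2.map (Rat.cast : ℚ → ℝ)).PosSemidef) :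
    ((s : ℝ) • ((matrixOfSparseRows n n sP).submatrix eι eι).map (Rat.cast : ℚ → ℝ)
        - S.Cᵀ * S.C).PosSemidef := by
  have hpsd := posSemidef_map_of_cliqueSweepS (K := ℝ) hchk hS
  rw [SMat.matrixOfSparseRows_sub, SMat.matrixOfSparseRows_smul, SMat.matrixOfSparseRows_mulT m n hn]
    at hpsd
  rw [hC, submatrix_map_smul_sub_transpose_mul]
  exact hpsd.submatrix _

/-- The same with the blocks certified by `ldlAll`.
[cite: ZhengFantuzziPapachristodoulou2018, §3.2 Theorem 2 («if» direction); BlekhermanParriloThomas2012, App. A.1.2] -/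
theorem smul_sub_transpose_mul_self_posSemidef_of_cliqueSweep_ldl (S : System ι κ) (eι : ι ≃ Fin n)
    (eκ : κ ≃ Fin m) (hn : n ≤ 2 ^ dn) (sC sP : SMat ℚ) (s : ℚ)
    (hC : S.C = ((matrixOfSparseRows m n sC).submatrix eκ eι).map (Rat.cast : ℚ → ℝ))
    {blocksR : List (Block n ℚ)}
    (hchk : cliqueSweepS n 0 n (SMat.sub (SMat.smul s sP) (SMat.mulT dn m sC sC)) blocksR = true)
    (hl : ldlAll blocksR = true) :
    ((s : ℝ) • ((matrixOfSparseRows n n sP).submatrix eι eι).map (Rat.cast : ℚ → ℝ)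
        - S.Cᵀ * S.C).PosSemidef :=
  smul_sub_transpose_mul_self_posSemidef_of_cliqueSweep S eι eκ hn sC sP s hC hchk
    (forall_posSemidef_of_ldlAll hl)

end RankOne

/-! ### §4c The three payoffs and the constructor from ESTABLISHED clique identities (any lane) —
the assembly when the `−𝓛` sweep is sharded into row WINDOWS across files (`N ≈ 10³` objects)

`SlabCertificate.ofSparse` consumes the two sweep DECIDES; at SP-118 scale (measured below) one
`−𝓛` sweep is ≈ 91 s of kernel in one file, and beyond that the sweep is cut into `k` row windows
`cliqueSweepS N (t·len) len (SMat.neg (slabSMat …)) blocks = true`, one file each, assembled into the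
IDENTITY `matrixOfSparseRows N N (SMat.neg (slabSMat …)) = blockSum blocks` by
`CliqueSumSparseCheck`'s `matrixOfSparseRows_eq_blockSum_of_sweepWindows len k hk (fun t => by
fin_cases t <;> [exact w₀; exact w₁; …])` (or, from one sweep, `matrixOfSparseRows_eq_blockSum' hchk`).
The versions below take the identities themselves, so every lane feeds the same constructor.
MEASURED (farm, 2026-08-27, gridfusion lit-5, sos-4's SPSYN-R236 census object `j267724`: `n = 354`,
`m = 260`, `N = 614`, `A`/`B`/`C`/`P` with 236/496/496/1 534 non-zeros, 258 `−𝓛` blocks `≤ 9`,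
234 `P` blocks `≤ 4`, `dn = dm = 9`; `B` rebuilt from the producer's model constructor, the producer's
multipliers carrying the channel weights `λ_e·w_e`): ONE sweep of `SMat.neg (slabSMat 354 260 9 9 …)`
≈ 91 s of kernel (file 119 s); TWO windows 48 / 71 s; THREE windows 40 / 43 / 59 s; the `P − ε·1` side
(sweep + `ldlAll` of the 234 blocks) one 59-s file; the 258 `−𝓛` blocks by `ldlWindow` in four files of
34–59 s (`CliqueSumBlockLDL`). -/

section AssemblyEq

variable {ι κ : Type*} [Fintype ι] [Fintype κ] [DecidableEq ι] [DecidableEq κ]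
variable {n m dn dm : ℕ}

/-- **`−𝓛 ⪰ 0` for a sparsely presented object from the clique IDENTITY of the expression**
(`matrixOfSparseRows (n+m) (n+m) (SMat.neg (slabSMat …)) = blockSum blocks`, established by one sweep,
by row windows in several files, or by the reference check) and the blocks' PSD facts.
[cite: ZhengFantuzziPapachristodoulou2018, §3.2 Theorem 2 («if» direction); Pai1981, §2.16 eq. (2.64)] -/
theorem neg_slabMatrix_posSemidef_of_eq_blockSum (S : System ι κ) (eι : ι ≃ Fin n) (eκ : κ ≃ Fin m)
    (hn : n ≤ 2 ^ dn) (hm : m ≤ 2 ^ dm) (sA sB sC sP : SMat ℚ) (η : ℚ) (lamf τf af bf : Fin m → ℚ)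
    (hA : S.A = ((matrixOfSparseRows n n sA).submatrix eι eι).map (Rat.cast : ℚ → ℝ))
    (hB : S.B = ((matrixOfSparseRows n m sB).submatrix eι eκ).map (Rat.cast : ℚ → ℝ))
    (hC : S.C = ((matrixOfSparseRows m n sC).submatrix eκ eι).map (Rat.cast : ℚ → ℝ))
    {blocks : List (Block (n + m) ℚ)}
    (hEq : matrixOfSparseRows (n + m) (n + m)
      (SMat.neg (slabSMat n m dn dm sA sB sC sP η lamf τf af bf)) = blockSum blocks)
    (hS : ∀ bk ∈ blocks, (bk.2.map (Rat.cast : ℚ → ℝ)).PosSemidef) :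
    (-(slabMatrix S (((matrixOfSparseRows n n sP).submatrix eι eι).map (Rat.cast : ℚ → ℝ)) (η : ℝ)
        (fun k => (lamf (eκ k) : ℝ)) (fun k => (τf (eκ k) : ℝ)) (fun k => (af (eκ k) : ℝ))
        (fun k => (bf (eκ k) : ℝ)))).PosSemidef := by
  have hpsd : ((matrixOfSparseRows (n + m) (n + m)
      (SMat.neg (slabSMat n m dn dm sA sB sC sP η lamf τf af bf))).map (Rat.cast : ℚ → ℝ)).PosSemidef := by
    rw [hEq]
    exact posSemidef_blockSum_map blocks hS
  rw [SMat.matrixOfSparseRows_neg] at hpsd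
  rw [slabMatrix_eq_sparse S eι eκ hn hm sA sB sC sP η lamf τf af bf hA hB hC, neg_submatrix_map]
  exact hpsd.submatrix _

omit [Fintype ι] in
/-- **`P − ε·1 ⪰ 0` for the sparsely presented `P` from the clique IDENTITY**
`matrixOfSparseRows n n (SMat.sub sP (SMat.scalar n ε)) = blockSum blocksP` (any lane) and the
`P`-blocks' PSD facts. [cite: ZhengFantuzziPapachristodoulou2018, §3.2 Theorem 2 («if» direction)] -/
theorem sub_smul_one_posSemidef_of_eq_blockSum (eι : ι ≃ Fin n) (sP : SMat ℚ) (ε : ℚ)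
    {blocksP : List (Block n ℚ)}
    (hEq : matrixOfSparseRows n n (SMat.sub sP (SMat.scalar n ε)) = blockSum blocksP)
    (hS : ∀ bk ∈ blocksP, (bk.2.map (Rat.cast : ℚ → ℝ)).PosSemidef) :
    (((matrixOfSparseRows n n sP).submatrix eι eι).map (Rat.cast : ℚ → ℝ)
        - (ε : ℝ) • (1 : Matrix ι ι ℝ)).PosSemidef := by
  have hpsd : ((matrixOfSparseRows n n (SMat.sub sP (SMat.scalar n ε))).map
      (Rat.cast : ℚ → ℝ)).PosSemidef := by
    rw [hEq]
    exact posSemidef_blockSum_map blocksP hS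
  rw [SMat.matrixOfSparseRows_sub, SMat.matrixOfSparseRows_scalar] at hpsd
  rw [submatrix_map_sub_smul_one]
  exact hpsd.submatrix _

omit [DecidableEq ι] [DecidableEq κ] in
/-- **`s•P − CᵀC ⪰ 0` (the level route's rank-one aggregate) from the clique IDENTITY**
`matrixOfSparseRows n n (SMat.sub (SMat.smul s sP) (SMat.mulT dn m sC sC)) = blockSum blocksR` (any lane).
[cite: ZhengFantuzziPapachristodoulou2018, §3.2 Theorem 2 («if» direction); VuTuritsyn2017, §4.3 Theorem 1] -/
theorem smul_sub_transpose_mul_self_posSemidef_of_eq_blockSum (S : System ι κ) (eι : ι ≃ Fin n)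
    (eκ : κ ≃ Fin m) (hn : n ≤ 2 ^ dn) (sC sP : SMat ℚ) (s : ℚ)
    (hC : S.C = ((matrixOfSparseRows m n sC).submatrix eκ eι).map (Rat.cast : ℚ → ℝ))
    {blocksR : List (Block n ℚ)}
    (hEq : matrixOfSparseRows n n (SMat.sub (SMat.smul s sP) (SMat.mulT dn m sC sC)) = blockSum blocksR)
    (hS : ∀ bk ∈ blocksR, (bk.2.map (Rat.cast : ℚ → ℝ)).PosSemidef) :
    ((s : ℝ) • ((matrixOfSparseRows n n sP).submatrix eι eι).map (Rat.cast : ℚ → ℝ)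
        - S.Cᵀ * S.C).PosSemidef := by
  have hpsd : ((matrixOfSparseRows n n (SMat.sub (SMat.smul s sP) (SMat.mulT dn m sC sC))).map
      (Rat.cast : ℚ → ℝ)).PosSemidef := by
    rw [hEq]
    exact posSemidef_blockSum_map blocksR hS
  rw [SMat.matrixOfSparseRows_sub, SMat.matrixOfSparseRows_smul, SMat.matrixOfSparseRows_mulT m n hn]
    at hpsd
  rw [hC, submatrix_map_smul_sub_transpose_mul]
  exact hpsd.submatrix _

/-- **One-term constructor of a slab certificate from the two clique IDENTITIES** (any lane — in
particular row-window decides spread over several files and assembled by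
`matrixOfSparseRows_eq_blockSum_of_sweepWindows`), the blocks' PSD facts and the scalar side
conditions over `ℚ`; `SlabCertificate.ofSparse` is the one-sweep special case.
[cite: Pai1981, §2.16 Theorem [18] eqs. (2.63)–(2.64); VuTuritsyn2017, §4.2 Lemma 1; ZhengFantuzziPapachristodoulou2018, §3.2 Theorem 2] -/
noncomputable def SlabCertificate.ofSparseEq (S : System ι κ) (eι : ι ≃ Fin n) (eκ : κ ≃ Fin m)
    (hn : n ≤ 2 ^ dn) (hm : m ≤ 2 ^ dm) (sA sB sC sP : SMat ℚ) (ε η : ℚ) (lamf τf af bf : Fin m → ℚ)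
    (hA : S.A = ((matrixOfSparseRows n n sA).submatrix eι eι).map (Rat.cast : ℚ → ℝ))
    (hB : S.B = ((matrixOfSparseRows n m sB).submatrix eι eκ).map (Rat.cast : ℚ → ℝ))
    (hC : S.C = ((matrixOfSparseRows m n sC).submatrix eκ eι).map (Rat.cast : ℚ → ℝ))
    (hε : 0 < ε) (hη : 0 < η) (hτ : ∀ k, 0 ≤ τf k) (hlam : ∀ k, 0 ≤ lamf k)
    (ha : ∀ k, 0 < lamf k → 0 ≤ af k)
    {blocksP : List (Block n ℚ)}
    (hEqP : matrixOfSparseRows n n (SMat.sub sP (SMat.scalar n ε)) = blockSum blocksP)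
    (hSP : ∀ bk ∈ blocksP, (bk.2.map (Rat.cast : ℚ → ℝ)).PosSemidef)
    {blocks : List (Block (n + m) ℚ)}
    (hEq : matrixOfSparseRows (n + m) (n + m)
      (SMat.neg (slabSMat n m dn dm sA sB sC sP η lamf τf af bf)) = blockSum blocks)
    (hS : ∀ bk ∈ blocks, (bk.2.map (Rat.cast : ℚ → ℝ)).PosSemidef) : SlabCertificate S where
  P := ((matrixOfSparseRows n n sP).submatrix eι eι).map (Rat.cast : ℚ → ℝ)
  ε := ε
  η := η
  τ := fun k => (τf (eκ k) : ℝ)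
  lam := fun k => (lamf (eκ k) : ℝ)
  a := fun k => (af (eκ k) : ℝ)
  b := fun k => (bf (eκ k) : ℝ)
  P_symm := transpose_eq_of_sub_smul_one_posSemidef
    (sub_smul_one_posSemidef_of_eq_blockSum eι sP ε hEqP hSP)
  ε_pos := by exact_mod_cast hε
  η_pos := by exact_mod_cast hη
  P_ge := sub_smul_one_posSemidef_of_eq_blockSum eι sP ε hEqP hSP
  τ_nonneg := fun k => by exact_mod_cast hτ (eκ k)
  lam_nonneg := fun k => by exact_mod_cast hlam (eκ k)
  a_nonneg_of_lam_pos := fun k hk => by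
    have hk' : 0 < lamf (eκ k) := by exact_mod_cast hk
    exact_mod_cast ha (eκ k) hk'
  lmi := neg_slabMatrix_posSemidef_of_eq_blockSum S eι eκ hn hm sA sB sC sP η lamf τf af bf hA hB hC
    hEq hS

/-- The certificate's `P` is the presented one. [cite: Pai1981, §2.16 eq. (2.63)] -/
theorem SlabCertificate.ofSparseEq_P (S : System ι κ) (eι : ι ≃ Fin n) (eκ : κ ≃ Fin m)
    (hn : n ≤ 2 ^ dn) (hm : m ≤ 2 ^ dm) (sA sB sC sP : SMat ℚ) (ε η : ℚ) (lamf τf af bf : Fin m → ℚ)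
    (hA : S.A = ((matrixOfSparseRows n n sA).submatrix eι eι).map (Rat.cast : ℚ → ℝ))
    (hB : S.B = ((matrixOfSparseRows n m sB).submatrix eι eκ).map (Rat.cast : ℚ → ℝ))
    (hC : S.C = ((matrixOfSparseRows m n sC).submatrix eκ eι).map (Rat.cast : ℚ → ℝ))
    (hε : 0 < ε) (hη : 0 < η) (hτ : ∀ k, 0 ≤ τf k) (hlam : ∀ k, 0 ≤ lamf k)
    (ha : ∀ k, 0 < lamf k → 0 ≤ af k)
    {blocksP : List (Block n ℚ)}
    (hEqP : matrixOfSparseRows n n (SMat.sub sP (SMat.scalar n ε)) = blockSum blocksP)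
    (hSP : ∀ bk ∈ blocksP, (bk.2.map (Rat.cast : ℚ → ℝ)).PosSemidef)
    {blocks : List (Block (n + m) ℚ)}
    (hEq : matrixOfSparseRows (n + m) (n + m)
      (SMat.neg (slabSMat n m dn dm sA sB sC sP η lamf τf af bf)) = blockSum blocks)
    (hS : ∀ bk ∈ blocks, (bk.2.map (Rat.cast : ℚ → ℝ)).PosSemidef) :
    (SlabCertificate.ofSparseEq S eι eκ hn hm sA sB sC sP ε η lamf τf af bf hA hB hC hε hη hτ hlam ha
      hEqP hSP hEq hS).P = ((matrixOfSparseRows n n sP).submatrix eι eι).map (Rat.cast : ℚ → ℝ) :=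
  rfl

/-- The certificate's slope vector (API). [cite: Pai1981, §2.16 eq. (2.63)] -/
theorem SlabCertificate.ofSparseEq_lam (S : System ι κ) (eι : ι ≃ Fin n) (eκ : κ ≃ Fin m)
    (hn : n ≤ 2 ^ dn) (hm : m ≤ 2 ^ dm) (sA sB sC sP : SMat ℚ) (ε η : ℚ) (lamf τf af bf : Fin m → ℚ)
    (hA : S.A = ((matrixOfSparseRows n n sA).submatrix eι eι).map (Rat.cast : ℚ → ℝ))
    (hB : S.B = ((matrixOfSparseRows n m sB).submatrix eι eκ).map (Rat.cast : ℚ → ℝ))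
    (hC : S.C = ((matrixOfSparseRows m n sC).submatrix eκ eι).map (Rat.cast : ℚ → ℝ))
    (hε : 0 < ε) (hη : 0 < η) (hτ : ∀ k, 0 ≤ τf k) (hlam : ∀ k, 0 ≤ lamf k)
    (ha : ∀ k, 0 < lamf k → 0 ≤ af k)
    {blocksP : List (Block n ℚ)}
    (hEqP : matrixOfSparseRows n n (SMat.sub sP (SMat.scalar n ε)) = blockSum blocksP)
    (hSP : ∀ bk ∈ blocksP, (bk.2.map (Rat.cast : ℚ → ℝ)).PosSemidef)
    {blocks : List (Block (n + m) ℚ)}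
    (hEq : matrixOfSparseRows (n + m) (n + m)
      (SMat.neg (slabSMat n m dn dm sA sB sC sP η lamf τf af bf)) = blockSum blocks)
    (hS : ∀ bk ∈ blocks, (bk.2.map (Rat.cast : ℚ → ℝ)).PosSemidef) (k : κ) :
    (SlabCertificate.ofSparseEq S eι eκ hn hm sA sB sC sP ε η lamf τf af bf hA hB hC hε hη hτ hlam ha
      hEqP hSP hEq hS).lam k = (lamf (eκ k) : ℝ) :=
  rfl

end AssemblyEq

/-! ## §4e Symmetry of the certificate matrix (structural, no decide)

For a symmetric `P` the certificate matrix is symmetric by its block formula — the hypothesis that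
lets a dense principal block of `−𝓛` reach the field-valued PSD lanes without a symmetry decide
(`Literature/Computation/Certificates/SparsePrincipalBlock.lean`,
`PSD.isHermitian_map_principalRows_of_transpose_eq` / `…_principal_of_transpose`). -/

section Symmetry

variable {ι κ : Type*} [Fintype ι] [Fintype κ] [DecidableEq ι] [DecidableEq κ]

/-- **The rational twin is symmetric when `P` is.** [cite: Pai1981, §2.16 eq. (2.64); VuTuritsyn2017, §4.2 Lemma 1] -/
theorem slabMatrixQ_transpose {A : Matrix ι ι ℚ} {B : Matrix ι κ ℚ} {C : Matrix κ ι ℚ}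
    {P : Matrix ι ι ℚ} (hP : Pᵀ = P) (η : ℚ) (lam τ a b : κ → ℚ) :
    (slabMatrixQ A B C P η lam τ a b)ᵀ = slabMatrixQ A B C P η lam τ a b := by
  rw [slabMatrixQ, Matrix.fromBlocks_transpose, Matrix.transpose_transpose]
  congr 1
  · rw [Matrix.transpose_sub, Matrix.transpose_add, Matrix.transpose_add, Matrix.transpose_mul,
      Matrix.transpose_mul, Matrix.transpose_transpose, hP, Matrix.transpose_smul, Matrix.transpose_one,
      Matrix.transpose_mul, Matrix.transpose_mul, Matrix.diagonal_transpose, Matrix.transpose_transpose,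
      Matrix.mul_assoc, add_comm (P * A)]
  · rw [Matrix.transpose_sub, Matrix.transpose_sub, Matrix.transpose_neg, Matrix.transpose_transpose,
      Matrix.diagonal_transpose, sub_right_comm (-(diagonal lam * (C * B)))]
    abel

/-- **The certificate matrix `𝓛` is symmetric when `P` is** (any system, any index types).
[cite: Pai1981, §2.16 eq. (2.64); VuTuritsyn2017, §4.2 Lemma 1] -/
theorem slabMatrix_transpose (S : System ι κ) {P : Matrix ι ι ℝ} (hP : Pᵀ = P) (η : ℝ)
    (lam τ a b : κ → ℝ) : (slabMatrix S P η lam τ a b)ᵀ = slabMatrix S P η lam τ a b := by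
  rw [slabMatrix, Matrix.fromBlocks_transpose, Matrix.transpose_transpose]
  congr 1
  · rw [slabL11, Matrix.transpose_sub, Matrix.transpose_add, Matrix.transpose_add, Matrix.transpose_mul,
      Matrix.transpose_mul, Matrix.transpose_transpose, hP, Matrix.transpose_smul, Matrix.transpose_one,
      Matrix.transpose_mul, Matrix.transpose_mul, Matrix.diagonal_transpose, Matrix.transpose_transpose,
      Matrix.mul_assoc, add_comm (P * S.A)]
  · rw [slabL22, Matrix.transpose_sub, Matrix.transpose_sub, Matrix.transpose_neg,
      Matrix.transpose_transpose, Matrix.diagonal_transpose, sub_right_comm (-(diagonal lam * (S.C * S.B)))]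
    abel

/-- Hence `−𝓛` is symmetric when `P` is — the `hT` hypothesis of the principal-block lane after
`slabMatrix_eq_sparse`. [cite: Pai1981, §2.16 eq. (2.64); VuTuritsyn2017, §4.2 Lemma 1] -/
theorem neg_slabMatrix_transpose (S : System ι κ) {P : Matrix ι ι ℝ} (hP : Pᵀ = P) (η : ℝ)
    (lam τ a b : κ → ℝ) : (-(slabMatrix S P η lam τ a b))ᵀ = -(slabMatrix S P η lam τ a b) := by
  rw [Matrix.transpose_neg, slabMatrix_transpose S hP]

/-- `P` is symmetric as soon as `P − ε·1` is positive semidefinite — so in every `SlabCertificate`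
the certificate matrix is symmetric with no further hypothesis. [cite: Pai1981, §2.16 eq. (2.64); VuTuritsyn2017, §4.2 Lemma 1] -/
theorem slabMatrix_transpose_of_sub_smul_one_posSemidef (S : System ι κ) {P : Matrix ι ι ℝ} {ε : ℝ}
    (hPε : (P - ε • (1 : Matrix ι ι ℝ)).PosSemidef) (η : ℝ) (lam τ a b : κ → ℝ) :
    (slabMatrix S P η lam τ a b)ᵀ = slabMatrix S P η lam τ a b :=
  slabMatrix_transpose S (transpose_eq_of_sub_smul_one_posSemidef hPε) η lam τ a b

end Symmetry

/-! ### §5 Kernel-checked toy example: one state, one channel -/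

section Example

/-- Toy sparse literal `A = [−1]`. [folklore] -/
private def toyA : SMat ℚ := [[(0, -1)]]
/-- Toy sparse literal `B = [1]`. [folklore] -/
private def toyB : SMat ℚ := [[(0, 1)]]
/-- Toy sparse literal `C = [1]`. [folklore] -/
private def toyC : SMat ℚ := [[(0, 1)]]
/-- Toy sparse literal `P = [1]`. [folklore] -/
private def toyP : SMat ℚ := [[(0, 1)]]

/-- The toy object, PRESENTED by its sparse literals (so the three presentation facts are `rfl`). [folklore] -/
private noncomputable def toyS : System (Fin 1) (Fin 1) where
  A := ((matrixOfSparseRows 1 1 toyA).submatrix (Equiv.refl (Fin 1)) (Equiv.refl (Fin 1))).map Rat.cast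
  B := ((matrixOfSparseRows 1 1 toyB).submatrix (Equiv.refl (Fin 1)) (Equiv.refl (Fin 1))).map Rat.cast
  C := ((matrixOfSparseRows 1 1 toyC).submatrix (Equiv.refl (Fin 1)) (Equiv.refl (Fin 1))).map Rat.cast
  δs := 0

/-- Certificate scalars: `η = 1/10`, `λ = 0`, `τ = 1`, sector `[1/2, 1]`; the `−𝓛` block
`[[12/5, 1/4], [1/4, 1]]` and the `P − ε·1` block `[[1/2]]` (`ε = 1/2`), one clique each. [folklore] -/
private def toyBlocks : List (Block (1 + 1) ℚ) := [⟨[0, 1], !![12/5, 1/4; 1/4, 1]⟩]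
/-- The `P`-side block. [folklore] -/
private def toyBlocksP : List (Block 1 ℚ) := [⟨[0], !![1/2]⟩]

/-- The `−𝓛` sweep against the EXPRESSION (one decide). -/
example : cliqueSweepS (1 + 1) 0 (1 + 1)
    (SMat.neg (slabSMat 1 1 0 0 toyA toyB toyC toyP (1/10) (fun _ => 0) (fun _ => 1) (fun _ => 1/2)
      (fun _ => 1))) toyBlocks = true := by
  decide +kernel

/-- The whole certificate in one term: presentation facts `rfl`, scalar conditions and sweeps by
`decide`, blocks by `ldlAll`. -/
noncomputable example : SlabCertificate toyS :=
  SlabCertificate.ofSparse toyS (Equiv.refl _) (Equiv.refl _) (dn := 0) (dm := 0) (by norm_num)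
    (by norm_num) toyA toyB toyC toyP (1/2) (1/10) (fun _ => 0) (fun _ => 1) (fun _ => 1/2) (fun _ => 1)
    rfl rfl rfl (by norm_num) (by norm_num) (by decide) (by decide) (by decide)
    (blocksP := toyBlocksP) (by decide +kernel) (forall_posSemidef_of_ldlAll (by decide +kernel))
    (blocks := toyBlocks) (by decide +kernel) (forall_posSemidef_of_ldlAll (by decide +kernel))

/-- The same certificate from the two clique IDENTITIES (here obtained from one sweep each by
`matrixOfSparseRows_eq_blockSum'`; for a large object from row windows by
`matrixOfSparseRows_eq_blockSum_of_sweepWindows`). -/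
noncomputable example : SlabCertificate toyS :=
  SlabCertificate.ofSparseEq toyS (Equiv.refl _) (Equiv.refl _) (dn := 0) (dm := 0) (by norm_num)
    (by norm_num) toyA toyB toyC toyP (1/2) (1/10) (fun _ => 0) (fun _ => 1) (fun _ => 1/2) (fun _ => 1)
    rfl rfl rfl (by norm_num) (by norm_num) (by decide) (by decide) (by decide)
    (blocksP := toyBlocksP) (matrixOfSparseRows_eq_blockSum' (by decide +kernel))
    (forall_posSemidef_of_ldlAll (by decide +kernel))
    (blocks := toyBlocks) (matrixOfSparseRows_eq_blockSum' (by decide +kernel))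
    (forall_posSemidef_of_ldlAll (by decide +kernel))

/-- The level route's aggregate for the toy object: `2•P − CᵀC = [1]`, one block, two decides. -/
example : (((2 : ℚ) : ℝ) • ((matrixOfSparseRows 1 1 toyP).submatrix (Equiv.refl (Fin 1)) (Equiv.refl (Fin 1))).map
      (Rat.cast : ℚ → ℝ) - toyS.Cᵀ * toyS.C).PosSemidef :=
  smul_sub_transpose_mul_self_posSemidef_of_cliqueSweep_ldl toyS (Equiv.refl _) (Equiv.refl _) (dn := 0)
    (by norm_num) toyC toyP 2 rfl (blocksR := [⟨[0], !![1]⟩]) (by decide +kernel) (by decide +kernel)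

end Example

end Literature.MathematicalPhysics.PowerSystems.LyapunovFunctionFamily
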